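import Literature.AlgebraicGeometry.Motives.AbelianVarietyWeilPairingNormalForm
import HarnessLib

/-!
# The algebraic Weil pairing read on a SECOND uniformising torus through an integer change of lattice
# (`mapMatrix`): transport of the Gram reading and of the `δ`-normal form

Layer `Literature/AlgebraicGeometry/Motives`, namespace `Literature.AlgebraicGeometry.Motives.AbelianVariety`.  PROOF FILE
(theorems only; no definition, no named fact).  Adapter between the two tori that occur in the Siegel moduli (U)-lane:
the J′-block uniformisation `φ : ComplexTorus Φ → A(ℂ)` (model `ℂ^{dim A}`, on which ★ `weilPairingLevel_eq_cexp_intGram` /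
`weilPairingLevel_eq_exp_pow_typeFormMod` live) and a marking torus `ComplexTorus Ψ` (e.g. the Siegel torus of
`siegelPeriodEquiv hδ hZ`, model `ℂ^g`, ★ `SiegelAdelicMarkingOfAnalytification`) mapped into it by the homomorphism of an INTEGER
matrix `T` on lattice coordinates (`ComplexTorus.mapMatrix Ψ Φ T`, lift `T_ℝ`, ★ `mapMatrix_proj`; every holomorphic
homomorphism of tori is of this form, Lange–Birkenhake §1.1.2 / the tree's `ComplexTorusMapsLinear`).  For `M`-torsion points
`P = φ(T(π_Ψ(x̃/M)))`, `Q = φ(T(π_Ψ(ỹ/M)))`: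

  `ē_M^Θ(P, Q) = e(2πi · ᵗx̃ (ᵗT G T) ỹ / M)`   (`G = intGram Φ E`, `E = c₁([𝒪(Θ)^an])`),

and if the PULLED-BACK lattice basis is symplectic of type `δ` (`ᵗT G T = E_δ = typeForm δ`) then
`ē_M^Θ(P, Q) = ζ_M ^ E_δ(x, y)`, `ζ_M = e(2πi/M)` — the `hpair` clause of ★ `SiegelAdelicMarking.exists_symplecticLift_of_levelReading`
read through a marking whose torsion parametrisation is `v ↦ φ(T(π_Ψ v))`.

## References
* [LangeBirkenhake1992] H. Lange, Ch. Birkenhake, *Complex Abelian Varieties* (1992), §1.1.2 (rational representation).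
* [Lange2023AbelianVarietiesComplex] H. Lange, *Abelian Varieties over the Complex Numbers* (2023), §1.5.1, §3.1, §2.7.4 Exercise (3).
* [GenestierNgo2020] A. Genestier, B. C. Ngô, *Lectures on Shimura varieties*, §1.2–§1.3 ((1.3.1)).
-/

noncomputable section

open CategoryTheory AlgebraicGeometry TopologicalSpace Set Function Filter Complex Matrix
open scoped Manifold Topology Real
open Literature.Geometry.Kaehler Literature.Geometry.Kaehler.ComplexTorus
open Literature.NumberTheory.Transcendental Literature.AlgebraicGeometry.HodgeTheory
open Literature.AlgebraicGeometry.ModuliOfAbelianVarieties (typeForm)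
open Literature.AlgebraicGeometry.AbelianSchemes (AbelianSchemeOver)

namespace Literature.AlgebraicGeometry.Motives.AbelianVariety

section TransportLemmas

variable {ι κ : Type} [Fintype ι] [Fintype κ] {E E' : Type} [NormedAddCommGroup E] [NormedSpace ℂ E]
  [NormedAddCommGroup E'] [NormedSpace ℂ E'] {Φ : (ι → ℝ) ≃L[ℝ] E} {Ψ : (κ → ℝ) ≃L[ℝ] E'}

omit [Fintype ι] in
/-- The lift of `mapMatrix T` at a rational lattice point: `T(π_Ψ(x̃/M)) = π_Φ((T x̃)/M)`.
[cite: LangeBirkenhake1992, §1.1.2] -/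
theorem mapMatrix_proj_inv_smul_intCast (T : Matrix ι κ ℤ) (M : ℕ) (x : κ → ℤ) :
    mapMatrix Ψ Φ T (proj Ψ ((M : ℝ)⁻¹ • fun i ↦ (x i : ℝ))) =
      proj Φ ((M : ℝ)⁻¹ • fun i ↦ ((T *ᵥ x) i : ℝ)) := by
  rw [mapMatrix_proj, Matrix.mulVec_smul]
  congr 1
  congr 1
  funext i
  simp only [Matrix.mulVec, dotProduct, Matrix.map_apply, Int.cast_sum, Int.cast_mul]

/-- `ᵗ(T x̃) G (T ỹ) = ᵗx̃ (ᵗT G T) ỹ`. [folklore] -/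
private theorem dotProduct_mulVec_mulVec_eq (G : Matrix ι ι ℤ) (T : Matrix ι κ ℤ) (x y : κ → ℤ) :
    (T *ᵥ x) ⬝ᵥ G *ᵥ (T *ᵥ y) = x ⬝ᵥ (Tᵀ * G * T) *ᵥ y := by
  rw [← Matrix.vecMul_transpose, ← Matrix.dotProduct_mulVec, Matrix.mulVec_mulVec, Matrix.mulVec_mulVec]

end TransportLemmas

section Transport

variable {A : AbelianVariety ℂ} {ι : Type} [Fintype ι] [DecidableEq ι] {Φ : (ι → ℝ) ≃L[ℝ] (Fin A.dim → ℂ)}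
  {φ : ComplexTorus Φ → ComplexPoints A.X} (hφ : IsAnalytification (Fin A.dim → ℂ) A.X A.dim φ)
  (hadd : ∀ x y, φ (x + y) = φ x * φ y)
  {κ : Type} [Fintype κ] {E' : Type} [NormedAddCommGroup E'] [NormedSpace ℂ E'] {Ψ : (κ → ℝ) ≃L[ℝ] E'}

include hφ hadd in
/-- **Gram reading through an integer change of lattice.**  For `M ≠ 0`, an integer matrix `T` on lattice coordinates (the
homomorphism `mapMatrix Ψ Φ T : ComplexTorus Ψ → ComplexTorus Φ`), integer vectors `x̃, ỹ ∈ ℤ^κ` and the `M`-torsion points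
`P = φ(T(π_Ψ(x̃/M)))`, `Q = φ(T(π_Ψ(ỹ/M)))`:  `ē_M^Θ(P, Q) = e(2πi · ᵗx̃ (ᵗT G T) ỹ / M)`, `G = intGram Φ E`,
`E = c₁([𝒪(Θ)^an])`. [cite: Lange2023AbelianVarietiesComplex, §1.5.1 and §2.7.4 Exercise (3)] [cite: LangeBirkenhake1992, §1.1.2] -/
theorem weilPairingLevel_eq_cexp_intGram_of_mapMatrix {M : ℕ} [IsDominant (Hom.toSchemeHom ((M : ℤ) • 𝟙 A))]
    (hM : M ≠ 0) (Θ : CartierDivisor A.X.left) (p : AHData Φ)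
    (hp : AHData.toPic p = picClass (cartierDivisorLineBundle hφ Θ)) (T : Matrix ι κ ℤ) (x y : κ → ℤ)
    (P Q : A.torsionPoints ℂ M)
    (hP : (P : A.Points ℂ) = φ (mapMatrix Ψ Φ T (proj Ψ ((M : ℝ)⁻¹ • fun i ↦ (x i : ℝ)))))
    (hQ : (Q : A.Points ℂ) = φ (mapMatrix Ψ Φ T (proj Ψ ((M : ℝ)⁻¹ • fun i ↦ (y i : ℝ))))) :
    (A.weilPairingLevel Θ P Q : ℂ) =
      cexp (2 * π * I * ((((x ⬝ᵥ (Tᵀ * intGram Φ p.form * T) *ᵥ y : ℤ) : ℝ) / M : ℝ) : ℂ)) := by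
  rw [mapMatrix_proj_inv_smul_intCast] at hP hQ
  rw [weilPairingLevel_eq_cexp_intGram hφ hadd hM Θ p hp (T *ᵥ x) (T *ᵥ y) P Q hP hQ, dotProduct_mulVec_mulVec_eq]

end Transport

section TransportTypeDelta

variable {A : AbelianVariety ℂ} {ι : Type} [Fintype ι] [DecidableEq ι] {Φ : (ι → ℝ) ≃L[ℝ] (Fin A.dim → ℂ)}
  {φ : ComplexTorus Φ → ComplexPoints A.X} (hφ : IsAnalytification (Fin A.dim → ℂ) A.X A.dim φ)
  (hadd : ∀ x y, φ (x + y) = φ x * φ y)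
  {g : ℕ} {δ : Fin g → ℕ} {E' : Type} [NormedAddCommGroup E'] [NormedSpace ℂ E']
  {Ψ : (Fin g ⊕ Fin g → ℝ) ≃L[ℝ] E'}

/-- `e(2πi k / M) = e(2πi / M) ^ (k mod M)` for an integer `k` (`M ≠ 0`). [folklore] -/
private theorem cexp_intCast_div_eq_pow' {M : ℕ} (hM : M ≠ 0) (k : ℤ) :
    cexp (2 * π * I * (((k : ℝ) / M : ℝ) : ℂ)) = cexp (2 * π * I / M) ^ ((k : ZMod M).val) := by
  haveI : NeZero M := ⟨hM⟩
  have hMc : (M : ℂ) ≠ 0 := Nat.cast_ne_zero.2 hM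
  set ζ := cexp (2 * π * I / M) with hζ
  have hζM : ζ ^ M = 1 := by
    rw [hζ, ← Complex.exp_nat_mul, mul_div_cancel₀ _ hMc, Complex.exp_two_pi_mul_I]
  have h1 : cexp (2 * π * I * (((k : ℝ) / M : ℝ) : ℂ)) = ζ ^ k := by
    rw [hζ, ← Complex.exp_int_mul]
    congr 1
    push_cast
    ring
  have hr : ((k : ZMod M).val : ℤ) = k % M := ZMod.val_intCast k
  have hk : k = M * (k / M) + ((k : ZMod M).val : ℤ) := by
    rw [hr]
    have := Int.emod_add_mul_ediv k (M : ℤ)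
    linarith
  rw [h1]
  conv_lhs => rw [hk]
  rw [zpow_add₀ (Complex.exp_ne_zero _), ← hζ, _root_.zpow_mul, zpow_natCast, hζM, _root_.one_zpow, one_mul,
    zpow_natCast]

include hφ hadd in
/-- **The `δ`-normal form through an integer change of lattice: `ē_M^Θ(φ T π_Ψ(x̃/M), φ T π_Ψ(ỹ/M)) = ζ_M ^ E_δ(x, y)`.**
If the lattice basis of the marking torus `ComplexTorus Ψ`, pushed by `T`, is symplectic of type `δ` for `E = c₁([𝒪(Θ)^an])`
(`ᵗT · intGram Φ E · T = typeForm δ`), then for `x, y ∈ (ℤ/M)^{2g}` and the `M`-torsion points at `T(π_Ψ(x̃/M))`,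
`T(π_Ψ(ỹ/M))`: the algebraic Weil pairing of `Θ` is `cexp (2πi/M) ^ (typeFormMod δ M x y).val` — the `hpair` clause of the B4
symplectic-lift construction for a marking with torsion parametrisation `v ↦ φ(T(π_Ψ v))`.
[cite: GenestierNgo2020, §1.2 and §1.3 (1.3.1)] [cite: Lange2023AbelianVarietiesComplex, §3.1 and §2.7.4 Exercise (3)]
[cite: LangeBirkenhake1992, §1.1.2] -/
theorem weilPairingLevel_eq_exp_pow_typeFormMod_of_mapMatrix {M : ℕ} [IsDominant (Hom.toSchemeHom ((M : ℤ) • 𝟙 A))]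
    (hM : M ≠ 0) (Θ : CartierDivisor A.X.left) (p : AHData Φ)
    (hp : AHData.toPic p = picClass (cartierDivisorLineBundle hφ Θ)) (T : Matrix ι (Fin g ⊕ Fin g) ℤ)
    (hT : Tᵀ * intGram Φ p.form * T = typeForm δ) (x y : Fin g ⊕ Fin g → ZMod M) (P Q : A.torsionPoints ℂ M)
    (hP : (P : A.Points ℂ) = φ (mapMatrix Ψ Φ T (proj Ψ ((M : ℝ)⁻¹ • fun i ↦ ((x i).val : ℝ)))))
    (hQ : (Q : A.Points ℂ) = φ (mapMatrix Ψ Φ T (proj Ψ ((M : ℝ)⁻¹ • fun i ↦ ((y i).val : ℝ))))) :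
    (A.weilPairingLevel Θ P Q : ℂ) = cexp (2 * π * I / M) ^ (AbelianSchemeOver.typeFormMod δ M x y).val := by
  haveI : NeZero M := ⟨hM⟩
  have hP' : (P : A.Points ℂ) =
      φ (mapMatrix Ψ Φ T (proj Ψ ((M : ℝ)⁻¹ • fun i ↦ ((((x i).val : ℕ) : ℤ) : ℝ)))) := by rw [hP]; rfl
  have hQ' : (Q : A.Points ℂ) =
      φ (mapMatrix Ψ Φ T (proj Ψ ((M : ℝ)⁻¹ • fun i ↦ ((((y i).val : ℕ) : ℤ) : ℝ)))) := by rw [hQ]; rfl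
  rw [weilPairingLevel_eq_cexp_intGram_of_mapMatrix hφ hadd hM Θ p hp T _ _ P Q hP' hQ', hT,
    cexp_intCast_div_eq_pow' hM, intCast_dotProduct_typeForm_mulVec]
  congr 3 <;> funext i <;> simp

end TransportTypeDelta

end Literature.AlgebraicGeometry.Motives.AbelianVariety

end
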